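import Summits.ResolutionOfSingularities.ResolutionOfSingularities.Theorems.FrobeniusLadderFRationalResolutionEtaleChartPrimaryCentre
import Mathlib.RingTheory.Jacobson.Ring
import Mathlib.FieldTheory.IsAlgClosed.Basic
import HarnessLib

/-!
# Crux `FrobeniusLadder.FRationalResolution` (stmt-ResolutionOfSingularities-15317), line `redirect`,
# stub `stub_diagonalizableQuotientResolution` — over an ALGEBRAICALLY CLOSED field the residue condition of brick E-k is
# automatic

Companion of `…EtaleChartPrimaryCentre.lean` (brick E-k: étale chart with TRIVIAL residue extension carrying a regular
`𝔪`-primary blow-up ⇒ local resolution datum at an isolated singular point). Over an algebraically closed ground field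
`K` the residue condition `κ(φ y) = κ(y)` holds at every point `y` of an étale `X`-scheme `Y` lying over a CLOSED point:
`𝔮_y` is maximal (primes of an unramified algebra over a maximal ideal are pairwise incomparable,
`Algebra.isUnramifiedAt_iff_map_eq`), `Γ(Y, V) / 𝔮_y` is a field of finite type over `K`, hence finite (Zariski's lemma,
Mathlib `finite_of_finite_type_of_isJacobsonRing`), hence `K` itself (`IsAlgClosed.algebraMap_bijective_of_isIntegral`).

* `isMaximal_of_isMaximal_comap_of_formallyUnramified` — ring form of "fibres of an unramified morphism over closed
  points consist of closed points";
* `stalkMap_residue_surjective_of_isAlgClosed` — **`𝒪_{X, φ y} → κ(y)` is onto** for `φ : Y → X` étale, `X` locally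
  of finite type over an algebraically closed `K`, `φ y` closed;
* **`hasResolution_of_isolated_etale_primaryBlowup_of_isAlgClosed`** — E-k's resolution theorem over algebraically
  closed fields WITHOUT the residue hypothesis: an integral `X` locally of finite type over `K = K̄` with finitely many
  singular points, each under a point `y` of an étale chart some affine neighbourhood of which carries a
  `𝔮_y`-primary ideal with regular blow-up, has a resolution of singularities.

Honest label: plumbing + assembly (no stub closed by name). No definitions, no named facts, no sorry.
[folklore; cite: Kollar2007, §2.2] [cite: StacksProject, Tag 02G7; Tag 00FZ]
-/

noncomputable section

-- single-problem summit: the doubled namespace component is forced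
set_option linter.dupNamespace false

open CategoryTheory AlgebraicGeometry TopologicalSpace
open Literature.AlgebraicGeometry.Resolution

namespace Summit.ResolutionOfSingularities.ResolutionOfSingularities.Theorems.FRationalResolution.EtaleChartPrimaryCentreAlgClosed

/-- **Over a maximal ideal, the primes of an unramified algebra are maximal** (they are pairwise incomparable: if
`𝔔 ≤ 𝔐` both lie over the maximal `𝔭` then `𝔭 C_𝔐 = 𝔐 C_𝔐 ≤ 𝔔 C_𝔐`, so `𝔔 = 𝔐`). [cite: StacksProject, Tag 02G7] -/
theorem isMaximal_of_isMaximal_comap_of_formallyUnramified {B C : Type} [CommRing B] [CommRing C] [Algebra B C]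
    [Algebra.FormallyUnramified B C] [Algebra.EssFiniteType B C]
    (𝔔 : Ideal C) [h𝔔 : 𝔔.IsPrime] (h𝔭 : (𝔔.comap (algebraMap B C)).IsMaximal) : 𝔔.IsMaximal := by
  obtain ⟨𝔐, h𝔐, hle⟩ := Ideal.exists_le_maximal 𝔔 h𝔔.ne_top
  suffices h : 𝔔 = 𝔐 by rw [h]; exact h𝔐
  set 𝔭 := 𝔔.comap (algebraMap B C) with h𝔭def
  have h𝔐𝔭 : 𝔐.comap (algebraMap B C) = 𝔭 :=
    (h𝔭.eq_of_le (Ideal.IsPrime.ne_top inferInstance) (Ideal.comap_mono hle)).symm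
  haveI : 𝔐.LiesOver 𝔭 := ⟨h𝔐𝔭.symm⟩
  haveI : Algebra.IsUnramifiedAt B 𝔐 := (Algebra.formallyUnramified_iff_forall).mp inferInstance ⟨𝔐, h𝔐.isPrime⟩
  have hunr : 𝔭.map (algebraMap B (Localization.AtPrime 𝔐)) = IsLocalRing.maximalIdeal (Localization.AtPrime 𝔐) := by
    letI := Localization.AtPrime.algebraOfLiesOver 𝔭 𝔐
    exact ((Algebra.isUnramifiedAt_iff_map_eq B 𝔭 𝔐).mp inferInstance).2
  -- `𝔪_{C_𝔐} = 𝔭 C_𝔐 ≤ 𝔔 C_𝔐`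
  have hdisj : Disjoint ((𝔐.primeCompl : Submonoid C) : Set C) (𝔔 : Set C) := by
    refine Set.disjoint_left.mpr ?_
    intro c hc hc𝔔
    exact hc (hle hc𝔔)
  haveI hQ' : (𝔔.map (algebraMap C (Localization.AtPrime 𝔐))).IsPrime :=
    IsLocalization.isPrime_of_isPrime_disjoint 𝔐.primeCompl _ 𝔔 h𝔔 hdisj
  have hle' : IsLocalRing.maximalIdeal (Localization.AtPrime 𝔐) ≤ 𝔔.map (algebraMap C (Localization.AtPrime 𝔐)) := by
    rw [← hunr, IsScalarTower.algebraMap_eq B C (Localization.AtPrime 𝔐), ← Ideal.map_map]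
    exact Ideal.map_mono Ideal.map_comap_le
  have hge' : 𝔔.map (algebraMap C (Localization.AtPrime 𝔐)) ≤ IsLocalRing.maximalIdeal (Localization.AtPrime 𝔐) :=
    IsLocalRing.le_maximalIdeal hQ'.ne_top
  have heq : 𝔔.map (algebraMap C (Localization.AtPrime 𝔐)) = IsLocalRing.maximalIdeal (Localization.AtPrime 𝔐) :=
    le_antisymm hge' hle'
  have h1 : (𝔔.map (algebraMap C (Localization.AtPrime 𝔐))).comap (algebraMap C (Localization.AtPrime 𝔐)) = 𝔔 :=
    IsLocalization.under_map_of_isPrime_disjoint 𝔐.primeCompl (Localization.AtPrime 𝔐) h𝔔 hdisj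
  have h2 : (IsLocalRing.maximalIdeal (Localization.AtPrime 𝔐)).comap (algebraMap C (Localization.AtPrime 𝔐)) = 𝔐 :=
    Localization.AtPrime.under_maximalIdeal
  rw [← h1, heq, h2]

/-- **Over an algebraically closed field, `𝒪_{X,x} → κ(y)` is onto at every point `y ↦ x` of an étale chart over a
closed point.** For `φ : Y → X` étale, `X` locally of finite type over an algebraically closed `K` and `φ y` closed:
every germ at `y` is congruent modulo `𝔪_y` to the pull-back of a germ at `φ y` (indeed of a constant from `K`):
`𝔮_y ⊆ Γ(Y, V)` is maximal by `isMaximal_of_isMaximal_comap_of_formallyUnramified`, and `Γ(Y, V)/𝔮_y` is a finite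
(Zariski's lemma) hence trivial extension of `K`. [cite: StacksProject, Tag 00FZ] -/
theorem stalkMap_residue_surjective_of_isAlgClosed {K : Type} [Field K] [IsAlgClosed K] {X Y : Scheme.{0}}
    (f : X ⟶ Spec (.of K)) [LocallyOfFiniteType f] (φ : Y ⟶ X) [Etale φ] (y : Y)
    (hx : IsClosed ({φ y} : Set X)) :
    ∀ c : Y.presheaf.stalk y, ∃ b : X.presheaf.stalk (φ y),
      c - (φ.stalkMap y).hom b ∈ IsLocalRing.maximalIdeal (Y.presheaf.stalk y) := by
  classical
  -- affine opens `U ∋ φ y`, `V ∋ y` with `V ⊆ φ⁻¹ U`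
  obtain ⟨U, hU, hxU, -⟩ := exists_isAffineOpen_mem_and_subset (U := ⊤) (Set.mem_univ (φ y))
  obtain ⟨V, hV, hyV, hVU⟩ := exists_isAffineOpen_mem_and_subset (U := φ ⁻¹ᵁ U) (show y ∈ φ ⁻¹ᵁ U from hxU)
  have e : V ≤ φ ⁻¹ᵁ U := hVU
  set 𝔭 := hU.primeIdealOf ⟨φ y, hxU⟩ with h𝔭def
  haveI h𝔭max : 𝔭.asIdeal.IsMaximal := hU.primeIdealOf_isMaximal_of_isClosed ⟨φ y, hxU⟩ hx
  -- the `K`-algebra `Γ(X, U)`, of finite type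
  set ι := hU.fromSpec with hιdef
  obtain ⟨gk, hgk⟩ := Spec.map_surjective (ι ≫ f)
  letI : Algebra K Γ(X, U) := gk.hom.toAlgebra
  haveI : Algebra.FiniteType K Γ(X, U) := by
    have h1 : LocallyOfFiniteType (Spec.map gk) := by rw [hgk]; infer_instance
    rw [HasRingHomProperty.Spec_iff (P := @LocallyOfFiniteType)] at h1
    exact h1
  -- the chart ring `Γ(Y, V)`, étale over `Γ(X, U)`
  set ψ := φ.appLE U V e with hψdef
  have hψ : ψ.hom.Etale := φ.etale_appLE hU hV e
  letI : Algebra Γ(X, U) Γ(Y, V) := ψ.hom.toAlgebra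
  haveI : Algebra.Etale Γ(X, U) Γ(Y, V) := hψ
  letI : Algebra K Γ(Y, V) := ((algebraMap Γ(X, U) Γ(Y, V)).comp (algebraMap K Γ(X, U))).toAlgebra
  haveI : IsScalarTower K Γ(X, U) Γ(Y, V) := IsScalarTower.of_algebraMap_eq (fun _ => rfl)
  haveI : Algebra.FiniteType K Γ(Y, V) := Algebra.FiniteType.trans (S := Γ(X, U)) inferInstance inferInstance
  set 𝔔 := hV.primeIdealOf ⟨y, hyV⟩ with h𝔔def
  have hcomap : 𝔔.asIdeal.comap (algebraMap Γ(X, U) Γ(Y, V)) = 𝔭.asIdeal := by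
    have h := hU.comap_primeIdealOf_appLE (f := φ) U V hV e hyV
    exact congrArg PrimeSpectrum.asIdeal h
  -- `𝔔` is maximal and `K → Γ(Y, V)/𝔔` is onto
  haveI h𝔔max : 𝔔.asIdeal.IsMaximal :=
    isMaximal_of_isMaximal_comap_of_formallyUnramified 𝔔.asIdeal (hcomap ▸ h𝔭max)
  letI : Field (Γ(Y, V) ⧸ 𝔔.asIdeal) := Ideal.Quotient.field 𝔔.asIdeal
  haveI : Module.Finite K (Γ(Y, V) ⧸ 𝔔.asIdeal) := finite_of_finite_type_of_isJacobsonRing K _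
  have hsurj : Function.Surjective (algebraMap K (Γ(Y, V) ⧸ 𝔔.asIdeal)) :=
    (IsAlgClosed.algebraMap_bijective_of_isIntegral (k := K) (K := Γ(Y, V) ⧸ 𝔔.asIdeal)).2
  -- read off the stalk
  intro c
  letI := X.presheaf.algebra_section_stalk ⟨φ y, hxU⟩
  haveI := hU.isLocalization_stalk ⟨φ y, hxU⟩
  letI := Y.presheaf.algebra_section_stalk ⟨y, hyV⟩
  haveI := hV.isLocalization_stalk ⟨y, hyV⟩
  obtain ⟨⟨c₁, s⟩, hcs⟩ := IsLocalization.surj 𝔔.asIdeal.primeCompl c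
  obtain ⟨a₁, ha₁⟩ := hsurj (Ideal.Quotient.mk 𝔔.asIdeal c₁)
  obtain ⟨a₂, ha₂⟩ := hsurj (Ideal.Quotient.mk 𝔔.asIdeal (s : Γ(Y, V)))
  have ha₁' : c₁ - algebraMap K Γ(Y, V) a₁ ∈ 𝔔.asIdeal := by
    rw [← Ideal.Quotient.mk_eq_mk_iff_sub_mem, ← ha₁, Ideal.Quotient.mk_algebraMap]
  have ha₂' : (s : Γ(Y, V)) - algebraMap K Γ(Y, V) a₂ ∈ 𝔔.asIdeal := by
    rw [← Ideal.Quotient.mk_eq_mk_iff_sub_mem, ← ha₂, Ideal.Quotient.mk_algebraMap]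
  have ha₂0 : a₂ ≠ 0 := by
    rintro rfl
    rw [map_zero, sub_zero] at ha₂'
    exact s.2 ha₂'
  -- the germ of the constant `a₁ / a₂`, pulled back from `x`
  set θ : K →+* Y.presheaf.stalk y := (algebraMap Γ(Y, V) (Y.presheaf.stalk y)).comp (algebraMap K Γ(Y, V))
    with hθdef
  refine ⟨(X.presheaf.germ U (φ y) hxU).hom (algebraMap K Γ(X, U) (a₁ / a₂)), ?_⟩
  have hpull : (φ.stalkMap y).hom ((X.presheaf.germ U (φ y) hxU).hom (algebraMap K Γ(X, U) (a₁ / a₂))) =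
      θ (a₁ / a₂) := by
    rw [← EtaleChartPrimaryCentre.germ_appLE_apply φ U V e y hyV]
    rfl
  rw [hpull]
  -- compute in the residue field
  set r := IsLocalRing.residue (Y.presheaf.stalk y) with hrdef
  rw [← IsLocalRing.residue_eq_zero_iff, map_sub]
  have hs : algebraMap Γ(Y, V) (Y.presheaf.stalk y) (s : Γ(Y, V)) ∉
      IsLocalRing.maximalIdeal (Y.presheaf.stalk y) := by
    rw [IsLocalization.AtPrime.to_map_mem_maximal_iff (Y.presheaf.stalk y) 𝔔.asIdeal]
    exact s.2
  have h1 : r (algebraMap Γ(Y, V) (Y.presheaf.stalk y) c₁) = r (θ a₁) := by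
    rw [← sub_eq_zero, ← map_sub, IsLocalRing.residue_eq_zero_iff]
    have := (IsLocalization.AtPrime.to_map_mem_maximal_iff (Y.presheaf.stalk y) 𝔔.asIdeal _).mpr ha₁'
    rwa [map_sub] at this
  have h2 : r (algebraMap Γ(Y, V) (Y.presheaf.stalk y) (s : Γ(Y, V))) = r (θ a₂) := by
    rw [← sub_eq_zero, ← map_sub, IsLocalRing.residue_eq_zero_iff]
    have := (IsLocalization.AtPrime.to_map_mem_maximal_iff (Y.presheaf.stalk y) 𝔔.asIdeal _).mpr ha₂'
    rwa [map_sub] at this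
  have hrs : r (algebraMap Γ(Y, V) (Y.presheaf.stalk y) (s : Γ(Y, V))) ≠ 0 := by
    rw [Ne, IsLocalRing.residue_eq_zero_iff]; exact hs
  have hθ2 : (r.comp θ) a₂ ≠ 0 := by
    rw [RingHom.comp_apply, ← h2]; exact hrs
  have hc : r c * r (algebraMap Γ(Y, V) (Y.presheaf.stalk y) (s : Γ(Y, V))) = r (θ a₁) := by
    rw [← map_mul, hcs, h1]
  rw [h2] at hc
  have hc' : r c = (r.comp θ) a₁ / (r.comp θ) a₂ := by
    rw [eq_div_iff hθ2]; exact hc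
  rw [hc', show r (θ (a₁ / a₂)) = (r.comp θ) (a₁ / a₂) from rfl, map_div₀, sub_self]

/-- **RESOLUTION OF VARIETIES OVER AN ALGEBRAICALLY CLOSED FIELD WHOSE ISOLATED SINGULARITIES ARE RESOLVED ÉTALE-LOCALLY BY
ONE `𝔪`-PRIMARY BLOW-UP.** Let `X` be an integral scheme locally of finite type over an algebraically closed field `K`
with finitely many singular points, each the image of a point `y` of an étale `X`-scheme `Y` such that some affine open
`V ∋ y` carries an ideal `J`, `𝔮_yⁿ ⊆ J ⊆ 𝔮_y`, whose blow-up is regular. Then `X` has a resolution of singularities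
(E-k with the residue condition discharged by `stalkMap_residue_surjective_of_isAlgClosed`). [cite: Kollar2007, §2.2] -/
theorem hasResolution_of_isolated_etale_primaryBlowup_of_isAlgClosed (K : Type) [Field K] [IsAlgClosed K]
    (X : Scheme.{0}) [IsIntegral X] (f : X ⟶ Spec (.of K)) [LocallyOfFiniteType f]
    (hfin : (Scheme.regularLocus X)ᶜ.Finite)
    (hchart : ∀ x : X, x ∉ Scheme.regularLocus X →
      ∃ (Y : Scheme.{0}) (φ : Y ⟶ X) (_ : Etale φ) (y : Y), φ y = x ∧
        ∃ (V : Y.Opens) (hV : IsAffineOpen V) (hyV : y ∈ V) (J : Ideal Γ(Y, V)) (n : ℕ),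
          (hV.primeIdealOf ⟨y, hyV⟩).asIdeal ^ n ≤ J ∧ J ≤ (hV.primeIdealOf ⟨y, hyV⟩).asIdeal ∧
            Scheme.IsRegular (affineBlowup J)) :
    Scheme.HasResolution X := by
  refine EtaleChartPrimaryCentre.hasResolution_of_isolated_etale_primaryBlowup K X f hfin fun x hx => ?_
  obtain ⟨Y, φ, _, y, hys, hbl⟩ := hchart x hx
  subst hys
  have hcl : IsClosed ({φ y} : Set X) := IsolatedClosed.isClosed_singleton_of_finite_singularLocus K X f hfin hx
  exact ⟨Y, φ, inferInstance, y, rfl, stalkMap_residue_surjective_of_isAlgClosed f φ y hcl, hbl⟩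

end Summit.ResolutionOfSingularities.ResolutionOfSingularities.Theorems.FRationalResolution.EtaleChartPrimaryCentreAlgClosed

end
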